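import Mathlib
import Literature.AlgebraicGeometry.ShimuraVarieties.UnitaryBallUnfolding
import Literature.AlgebraicGeometry.ShimuraVarieties.UnitaryBallChartDensity
import Literature.NumberTheory.Transcendental.FormIntegrationPUProofs
import Literature.Analysis.Complex.SeveralVariables
import HarnessLib

/-!
# The integral of a top form on a compact ball quotient as an integral over a fundamental domain

For a unitary ball-quotient datum `D : UnitaryBallUniformisationDatum 2 X₂`, a Hodge model `A` of `X₂`
(compact, real model space of dimension `4`) and a Sylvester frame `𝔣`, with uniformization
`ψ = D.modelUnif A 𝔣 : 𝔹² → X^an`, we PROVE the **chart formula**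

  `∫_{(X^an, o)} β = ε(o) · κ · ∫_𝓕 topDensity β dλ`            (`integral_eq_smul_setIntegral`;
  with the integrability of `topDensity β` on `𝓕`: `integrableOn_topDensity_and_integral_eq`)

for every continuous orientation family `o`, every smooth top-degree form `β` whose ball density
`topDensity β z = β_{ψ z}(dψ_z e₀, dψ_z (i e₀), dψ_z e₁, dψ_z (i e₁))` is continuous, every subgroup
`Δ ≤ U(2,1)` which is the image of `Γ`, and every measurable fundamental domain `𝓕 ⊆ 𝔹²` of `Δ`
for the Lebesgue measure; here `ε(o) = ±1` is the (constant) orientation sign of `ψ`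
(`orientSign_eq`, `orientSign_center_ne_zero`) and `κ > 0` is the ratio of the Haar measure of the
standard real basis of `ℂ²` to Mathlib's `volume` (`ballHaarFactor`).

Proof (Warner (1983), 4.8; Lee (2013), Props. 16.4–16.6; Borel (1997), §5.14): the orientation sign
is locally constant (continuity of `o` read through the holomorphic local inverses of `ψ`) hence
constant on the (star-convex) ball; `∫_X β` may be computed with ANY partition of unity subordinate
to chart sources (the tree's `MForm.integralPU_eq_integral_holds`), and we choose one subordinate
to patches carrying holomorphic local inverses `g` of `ψ` (`ChartInverseAt`); on each patch the
chart integrand is `|det dg| · (ρ · topDensity β) ∘ g` (`ChartInverseAt.chartIntegrand_eq`), so the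
change of variables formula (`integral_image_eq_integral_abs_det_fderiv_smul`) turns the chart
integral into `ε κ ∫_{sheet} (ρ ∘ ψ) · topDensity β dλ`; each sheet is unfolded onto `𝓕`
(`BallUnfolding.setIntegral_sheet_eq_setIntegral_fundamentalDomain`, the density being
Jacobian-twisted, `topDensity_eq_det_mul`), and `∑ ρ = 1` reassembles the pieces.

References: [Warner1983, §4.8], [Lee2013, Ch. 16], [Borel1997, §5.14].

## Provenance

Written under the LEAN-IN-TREE rule for the pub-hodgecm formalisation cell (model-construction
sub-cell, seat mc-unitary-3 gen 2, node D2-chart). Everything here is kernel-checked; nothing is a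
claim of the manuscripts adjudicated by that cell.
-/

set_option autoImplicit false

noncomputable section

open Matrix MulAction Function Set Filter Complex Module MeasureTheory
open scoped Manifold Topology NNReal Pointwise ENNReal
open Literature.Geometry.ComplexHyperbolic
open Literature.Geometry.ComplexHyperbolic.BallModel (U21 Ball Jac nsq actVec ballVolume)
open Literature.NumberTheory.Transcendental
open Literature.AlgebraicGeometry.HodgeTheory (HodgeModel)
open Literature.Geometry.Kaehler (MForm IsSmoothForm)
open Literature.Analysis.Complex

namespace Literature.AlgebraicGeometry.ShimuraVarieties

/-! ### The ball is preconnected; the Haar factor of the standard basis -/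

namespace BallUnfolding

/-- The open unit ball of `ℂ²` is star-convex at the origin. [folklore] -/
theorem starConvex_ballSet : StarConvex ℝ (0 : Fin 2 → ℂ) {w : Fin 2 → ℂ | nsq w < 1} := by
  rw [starConvex_zero_iff]
  intro x hx a ha0 ha1
  simp only [mem_setOf_eq, nsq] at hx ⊢
  have h0 : ‖(a • x) 0‖ = a * ‖x 0‖ := by
    rw [Pi.smul_apply, norm_smul, Real.norm_of_nonneg ha0]
  have h1 : ‖(a • x) 1‖ = a * ‖x 1‖ := by
    rw [Pi.smul_apply, norm_smul, Real.norm_of_nonneg ha0]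
  rw [h0, h1]
  have hS : 0 ≤ ‖x 0‖ ^ 2 + ‖x 1‖ ^ 2 := by positivity
  nlinarith [mul_le_one₀ ha1 ha0 ha1, sq_nonneg a]

/-- The open unit ball `𝔹²` is second countable. [folklore] -/
instance instSecondCountableTopologyBall : SecondCountableTopology Ball :=
  inferInstanceAs (SecondCountableTopology {z : Fin 2 → ℂ // nsq z < 1})

/-- The open unit ball `𝔹²` is preconnected. [folklore] -/
instance instPreconnectedSpaceBall : PreconnectedSpace Ball := by
  have h : IsPreconnected {w : Fin 2 → ℂ | nsq w < 1} :=
    (starConvex_ballSet.isPathConnected (by simp [nsq])).isConnected.isPreconnected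
  exact Subtype.preconnectedSpace h

/-- **The Haar factor `κ`** of the standard real basis `(e₀, i e₀, e₁, i e₁)` of `ℂ²`: the positive
real with `ballBasis.addHaar = κ • volume`. [folklore] -/
def ballHaarFactor : ℝ≥0 :=
  (ballBasis.addHaar).addHaarScalarFactor (volume : Measure (Fin 2 → ℂ))

/-- `ballBasis.addHaar = κ • volume`. [folklore] -/
theorem addHaar_ballBasis_eq : ballBasis.addHaar = ballHaarFactor • (volume : Measure (Fin 2 → ℂ)) :=
  Measure.isAddLeftInvariant_eq_smul _ _

/-- `0 < κ`. [folklore] -/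
theorem ballHaarFactor_pos : 0 < ballHaarFactor :=
  Measure.addHaarScalarFactor_pos_of_isAddHaarMeasure _ _

end BallUnfolding

open BallUnfolding

namespace UnitaryBallUniformisationDatum

variable {X₂ : Motives.SchemeOver ℂ} (D : UnitaryBallUniformisationDatum 2 X₂) (A : HodgeModel 2 X₂)
  (𝔣 : D.SylvesterFrame)

/-! ### The orientation sign of `ψ` is constant -/

section OrientSign

variable [Fact (finrank ℝ A.model = 4)]

namespace ChartInverseAt

variable {D A 𝔣} {x₀ : A.carrier} {z : Ball} (c : D.ChartInverseAt A 𝔣 x₀ z)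

/-- `y ↦ T_y = dg_y ∘ Θ` is continuous on `W` (holomorphic maps are `C¹`). [folklore] -/
theorem continuousOn_T : ContinuousOn c.T c.W := by
  have h0 : ContinuousOn (fderiv ℂ c.g) c.W := SCV.continuousOn_fderiv c.differentiableOn c.isOpen
  have h1 : Continuous fun L : A.model →L[ℂ] (Fin 2 → ℂ) ↦ L.restrictScalars ℝ :=
    (ContinuousLinearMap.restrictScalarsL ℂ A.model (Fin 2 → ℂ) ℝ ℝ).continuous
  have h2 : ContinuousOn (fun y ↦ fderiv ℝ c.g y) c.W := by
    refine (h1.comp_continuousOn h0).congr fun y hy ↦ ?_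
    exact (c.differentiableOn.differentiableAt (c.isOpen.mem_nhds hy)).fderiv_restrictScalars ℝ
  exact h2.clm_comp continuousOn_const

/-- `y ↦ det T_y` is continuous on `W`. [folklore] -/
theorem continuousOn_det_T : ContinuousOn (fun y ↦ (c.T y).det) c.W :=
  ContinuousLinearMap.continuous_det.comp_continuousOn c.continuousOn_T

end ChartInverseAt

/-- **The orientation sign of `ψ` is locally constant and nonzero** (continuity of the
orientation family read through a holomorphic local inverse of `ψ`). [cite: Lee2013, Ch. 15] -/
theorem exists_orientSign_eventuallyEq
    (o : (x : A.carrier) → Orientation ℝ (TangentSpace 𝓘(ℝ, A.model) x) (Fin 4))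
    (ho : IsContinuousOrientation o) (z₀ : Ball) :
    ∃ ε : ℝ, ε ≠ 0 ∧ ∀ᶠ z in 𝓝 z₀, D.orientSign A 𝔣 o z = ε := by
  set x₀ : A.carrier := D.modelUnif A 𝔣 z₀.1 with hx₀
  set φ := extChartAt 𝓘(ℝ, A.model) x₀ with hφ
  have hsrc : D.modelUnif A 𝔣 z₀.1 ∈ (chartAt A.model x₀).source := mem_chart_source A.model x₀
  obtain ⟨c⟩ := D.nonempty_chartInverseAt A 𝔣 x₀ z₀ hsrc
  have hsrcE : x₀ ∈ φ.source := by
    rw [hφ, extChartAt_source]; exact mem_chart_source A.model x₀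
  set y₀ : A.model := φ x₀ with hy₀
  have hy₀W : y₀ ∈ c.W := c.center_mem
  -- (1) the chart sign is constant near `x₀` and nonzero at `y₀`
  have h1 : ∀ᶠ x in 𝓝 x₀, chartSign o x₀ (φ x) = chartSign o x₀ y₀ :=
    ho.eventually_chartSign_extChartAt_eq hsrcE
  have hs₀ : chartSign o x₀ y₀ ≠ 0 :=
    ((ho x₀).self_of_nhdsWithin
      (by rw [ModelWithCorners.Boundaryless.range_eq_univ]; exact mem_univ _)).2
  -- (2) the sign of `det T_y` is constant near `y₀`
  have hT₀ : (c.T y₀).det ≠ 0 := by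
    intro h
    apply hs₀
    rw [c.chartSign_eq o hy₀W, h, Real.sign_zero, zero_mul]
  have hTc : ContinuousAt (fun y ↦ (c.T y).det) y₀ :=
    c.continuousOn_det_T.continuousAt (c.isOpen.mem_nhds hy₀W)
  set t₀ : ℝ := Real.sign (c.T y₀).det with ht₀
  have ht1 : t₀ * t₀ = 1 := by
    rcases lt_trichotomy (c.T y₀).det 0 with hneg | h0 | hpos
    · rw [ht₀, Real.sign_of_neg hneg]; norm_num
    · exact absurd h0 hT₀
    · rw [ht₀, Real.sign_of_pos hpos]; norm_num
  have h2 : ∀ᶠ y in 𝓝 y₀, Real.sign (c.T y).det = t₀ := by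
    rcases lt_trichotomy (c.T y₀).det 0 with hneg | h0 | hpos
    · filter_upwards [hTc.eventually_lt continuousAt_const hneg] with y hy
      rw [Real.sign_of_neg hy, ht₀, Real.sign_of_neg hneg]
    · exact absurd h0 hT₀
    · filter_upwards [continuousAt_const.eventually_lt hTc hpos] with y hy
      rw [Real.sign_of_pos hy, ht₀, Real.sign_of_pos hpos]
  -- (3) transport to the ball along `Y = φ ∘ ψ`
  have hψc : Continuous fun z : Ball ↦ D.modelUnif A 𝔣 z.1 :=
    (D.continuousOn_modelUnif A 𝔣).comp_continuous continuous_subtype_val fun z ↦ z.2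
  have hψt : Tendsto (fun z : Ball ↦ D.modelUnif A 𝔣 z.1) (𝓝 z₀) (𝓝 x₀) := hψc.continuousAt
  have hY : Tendsto (fun z : Ball ↦ φ (D.modelUnif A 𝔣 z.1)) (𝓝 z₀) (𝓝 y₀) :=
    (continuousAt_extChartAt (I := 𝓘(ℝ, A.model)) x₀).tendsto.comp hψt
  have E1 : ∀ᶠ z : Ball in 𝓝 z₀, D.modelUnif A 𝔣 z.1 ∈ φ.source :=
    hψt.eventually ((isOpen_extChartAt_source (I := 𝓘(ℝ, A.model)) x₀).mem_nhds hsrcE)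
  have E2 : ∀ᶠ z : Ball in 𝓝 z₀,
      chartSign o x₀ (φ (D.modelUnif A 𝔣 z.1)) = chartSign o x₀ y₀ := hψt.eventually h1
  have E3 : ∀ᶠ z : Ball in 𝓝 z₀, φ (D.modelUnif A 𝔣 z.1) ∈ c.W :=
    hY.eventually (c.isOpen.mem_nhds hy₀W)
  have E4 : ∀ᶠ z : Ball in 𝓝 z₀, Real.sign (c.T (φ (D.modelUnif A 𝔣 z.1))).det = t₀ :=
    hY.eventually h2
  refine ⟨t₀ * chartSign o x₀ y₀, mul_ne_zero (fun h ↦ ?_) hs₀, ?_⟩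
  · rw [h, mul_zero] at ht1; exact zero_ne_one ht1
  filter_upwards [E1, E2, E3, E4] with z hz1 hz2 hz3 hz4
  have key := c.chartSign_eq o hz3
  rw [hz2, hz4] at key
  -- the ball point `g (φ (ψ z))` is a `Γ`-translate of `z`
  have hψeq : D.modelUnif A 𝔣 (c.gBall hz3).1 = D.modelUnif A 𝔣 z.1 := by
    change D.modelUnif A 𝔣 (c.g (φ (D.modelUnif A 𝔣 z.1))) = _
    rw [← c.symm_eq _ hz3]
    exact φ.left_inv hz1
  obtain ⟨γ, hγ⟩ := (D.modelUnif_eq_iff A 𝔣 (c.gBall hz3) z).1 hψeq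
  have hrel : D.orientSign A 𝔣 o (c.gBall hz3) = D.orientSign A 𝔣 o z := by
    have h := D.orientSign_smul A 𝔣 o γ (c.gBall hz3)
    rw [hγ] at h
    exact h.symm
  rw [hrel] at key
  calc D.orientSign A 𝔣 o z = t₀ * t₀ * D.orientSign A 𝔣 o z := by rw [ht1, one_mul]
    _ = t₀ * chartSign o x₀ y₀ := by rw [key, mul_assoc]

/-- **The orientation sign of `ψ` is constant on the ball** (locally constant on a preconnected
space): `orientSign o z = orientSign o 0`. [cite: Lee2013, Ch. 15] -/
theorem orientSign_eq
    (o : (x : A.carrier) → Orientation ℝ (TangentSpace 𝓘(ℝ, A.model) x) (Fin 4))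
    (ho : IsContinuousOrientation o) (z : Ball) :
    D.orientSign A 𝔣 o z = D.orientSign A 𝔣 o BallModel.x₀ := by
  have hloc : IsLocallyConstant (D.orientSign A 𝔣 o) := by
    rw [IsLocallyConstant.iff_eventually_eq]
    intro w
    obtain ⟨ε, -, hε⟩ := D.exists_orientSign_eventuallyEq A 𝔣 o ho w
    have hw : D.orientSign A 𝔣 o w = ε := hε.self_of_nhds
    filter_upwards [hε] with w' hw'
    rw [hw', hw]
  exact hloc.apply_eq_of_preconnectedSpace z BallModel.x₀

/-- **The orientation sign of `ψ` is `±1`, in particular nonzero.** [cite: Lee2013, Ch. 15] -/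
theorem orientSign_center_ne_zero
    (o : (x : A.carrier) → Orientation ℝ (TangentSpace 𝓘(ℝ, A.model) x) (Fin 4))
    (ho : IsContinuousOrientation o) :
    D.orientSign A 𝔣 o BallModel.x₀ ≠ 0 := by
  obtain ⟨ε, hε, h⟩ := D.exists_orientSign_eventuallyEq A 𝔣 o ho BallModel.x₀
  rw [h.self_of_nhds]
  exact hε

end OrientSign

/-! ### Sheets over chart patches and the change of variables -/

section ChartPiece

variable [MeasurableSpace A.model] [BorelSpace A.model] [Fact (finrank ℝ A.model = 4)]

omit [MeasurableSpace A.model] [BorelSpace A.model] in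
/-- `modelBasis A.model 4 = Θ (ballBasis)`. [folklore] -/
theorem modelBasis_eq_map : modelBasis A.model 4 = ballBasis.map (modelIso A).toLinearEquiv :=
  Basis.eq_of_apply_eq fun k ↦ by simp [Basis.map_apply]

/-- The reference Haar measure of `A.model` is the push-forward of `ballBasis.addHaar` along `Θ`.
[folklore] -/
theorem addHaar_modelBasis_eq :
    (modelBasis A.model 4).addHaar = Measure.map (modelIso A) ballBasis.addHaar := by
  rw [modelBasis_eq_map A]
  exact (Basis.map_addHaar ballBasis (modelIso A)).symm

namespace ChartInverseAt

variable {D A 𝔣} {x₀ : A.carrier} {z : Ball} (c : D.ChartInverseAt A 𝔣 x₀ z)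

/-- The **sheet** `g(K) ⊆ 𝔹²` over a set `K` of chart points. [folklore] -/
def sheet (K : Set A.model) : Set Ball := {w : Ball | w.1 ∈ c.g '' K}

omit [MeasurableSpace A.model] [BorelSpace A.model] [Fact (finrank ℝ A.model = 4)] in
/-- The sheet read in `ℂ²` is `g(K)`. [folklore] -/
theorem image_val_sheet {K : Set A.model} (hKW : K ⊆ c.W) :
    Subtype.val '' c.sheet K = c.g '' K := by
  apply Subset.antisymm
  · rintro _ ⟨w, hw, rfl⟩; exact hw
  · rintro _ ⟨y, hy, rfl⟩; exact ⟨⟨c.g y, c.mapsTo (hKW hy)⟩, ⟨y, hy, rfl⟩, rfl⟩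

omit [MeasurableSpace A.model] [BorelSpace A.model] [Fact (finrank ℝ A.model = 4)] in
/-- Sheets over compact sets are compact. [folklore] -/
theorem isCompact_sheet {K : Set A.model} (hKc : IsCompact K) (hKW : K ⊆ c.W) :
    IsCompact (c.sheet K) := by
  have hind : Topology.IsInducing (fun w : Ball ↦ (w.1 : Fin 2 → ℂ)) :=
    Topology.IsInducing.subtypeVal
  rw [hind.isCompact_iff]
  change IsCompact (Subtype.val '' c.sheet K)
  rw [c.image_val_sheet hKW]
  exact hKc.image_of_continuousOn (c.differentiableOn.continuousOn.mono hKW)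

omit [MeasurableSpace A.model] [BorelSpace A.model] [Fact (finrank ℝ A.model = 4)] in
/-- Sheets over compact sets are measurable. [folklore] -/
theorem measurableSet_sheet {K : Set A.model} (hKc : IsCompact K) (hKW : K ⊆ c.W) :
    MeasurableSet (c.sheet K) :=
  (c.isCompact_sheet hKc hKW).isClosed.measurableSet

omit [MeasurableSpace A.model] [BorelSpace A.model] [Fact (finrank ℝ A.model = 4)] in
/-- `ψ` is injective on a sheet (`ψ ∘ g = c⁻¹` is injective on the chart target). [folklore] -/
theorem injOn_modelUnif_sheet {K : Set A.model} (hKW : K ⊆ c.W) :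
    InjOn (fun w : Ball ↦ D.modelUnif A 𝔣 w.1) (c.sheet K) := by
  rintro ⟨_, h1⟩ ⟨y, hy, rfl⟩ ⟨_, h2⟩ ⟨y', hy', rfl⟩ h
  have hyy : y = y' := by
    have h' : (extChartAt 𝓘(ℝ, A.model) x₀).symm y = (extChartAt 𝓘(ℝ, A.model) x₀).symm y' := by
      rw [c.symm_eq y (hKW hy), c.symm_eq y' (hKW hy')]
      exact h
    exact (extChartAt 𝓘(ℝ, A.model) x₀).symm.injOn (c.mem_target (hKW hy))
      (c.mem_target (hKW hy')) h'
  subst hyy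
  rfl

/-- **The chart integral over a compact piece of a chart-inverse patch is an integral over its
sheet**: `∫_K chartSign · (ρ ∘ c⁻¹) · β̂(e) dμ_e = ε κ ∫_{g(K)} (ρ ∘ ψ) · topDensity β dλ`
(change of variables `y ↦ g y`, Lee (2013), Prop. 16.6 / Thm. C.26). [cite: Lee2013, Ch. 16] -/
theorem setIntegral_chartIntegrand_eq
    (o : (x : A.carrier) → Orientation ℝ (TangentSpace 𝓘(ℝ, A.model) x) (Fin 4)) {ε : ℝ}
    (hε : ∀ w : Ball, D.orientSign A 𝔣 o w = ε)
    (ρ : A.carrier → ℝ) (β : MForm 𝓘(ℝ, A.model) A.carrier ℝ 4)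
    {K : Set A.model} (hKc : IsCompact K) (hKW : K ⊆ c.W) :
    ∫ y in K, chartSign o x₀ y * ρ ((extChartAt 𝓘(ℝ, A.model) x₀).symm y) *
        β.inChart x₀ y (modelBasis A.model 4) ∂(modelBasis A.model 4).addHaar =
      ε * (ballHaarFactor : ℝ) *
        ∫ w in c.sheet K, ρ (D.modelUnif A 𝔣 w.1) * D.topDensity A 𝔣 β w ∂ballVolume := by
  -- the ball integrand, extended by zero to `ℂ²`
  set G : (Fin 2 → ℂ) → ℝ := fun v ↦
    if h : nsq v < 1 then ρ (D.modelUnif A 𝔣 v) * D.topDensity A 𝔣 β ⟨v, h⟩ else 0 with hG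
  have hGball : ∀ w : Ball, G w.1 = ρ (D.modelUnif A 𝔣 w.1) * D.topDensity A 𝔣 β w := by
    intro w
    simp only [hG, dif_pos w.2, Subtype.coe_eta]
  -- Step 1: the integrand on `K`
  have h1 : ∫ y in K, chartSign o x₀ y * ρ ((extChartAt 𝓘(ℝ, A.model) x₀).symm y) *
        β.inChart x₀ y (modelBasis A.model 4) ∂(modelBasis A.model 4).addHaar =
      ∫ y in K, ε * (|(c.T y).det| * G (c.g y)) ∂(modelBasis A.model 4).addHaar := by
    refine setIntegral_congr_fun hKc.measurableSet fun y hy ↦ ?_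
    have hGy : G (c.g y) = ρ (D.modelUnif A 𝔣 (c.g y)) * D.topDensity A 𝔣 β (c.gBall (hKW hy)) :=
      hGball (c.gBall (hKW hy))
    rw [c.chartIntegrand_eq o ρ β (hKW hy), hε, hGy]
    ring
  -- Step 2: transport to `ℂ²` along `Θ`
  set Θ := modelIso A with hΘ
  have h2 : ∫ y in K, ε * (|(c.T y).det| * G (c.g y)) ∂(modelBasis A.model 4).addHaar =
      ∫ v in Θ ⁻¹' K, ε * (|(c.T (Θ v)).det| * G (c.g (Θ v))) ∂ballBasis.addHaar := by
    rw [addHaar_modelBasis_eq A]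
    have h := setIntegral_map_equiv (μ := ballBasis.addHaar) Θ.toHomeomorph.toMeasurableEquiv
      (fun y ↦ ε * (|(c.T y).det| * G (c.g y))) K
    simp only [Homeomorph.toMeasurableEquiv_coe, ContinuousLinearEquiv.coe_toHomeomorph] at h
    exact h
  -- Step 3: the Haar factor
  have h3 : ∫ v in Θ ⁻¹' K, ε * (|(c.T (Θ v)).det| * G (c.g (Θ v))) ∂ballBasis.addHaar =
      (ballHaarFactor : ℝ) *
        ∫ v in Θ ⁻¹' K, ε * (|(c.T (Θ v)).det| * G (c.g (Θ v))) ∂volume := by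
    rw [addHaar_ballBasis_eq, Measure.restrict_smul, integral_smul_nnreal_measure, NNReal.smul_def,
      smul_eq_mul]
  -- Step 4: change of variables `v ↦ g (Θ v)` on `Θ ⁻¹' K`
  have hS : MeasurableSet (Θ ⁻¹' K) := (hKc.isClosed.preimage Θ.continuous).measurableSet
  have hderiv : ∀ v ∈ Θ ⁻¹' K, HasFDerivWithinAt (c.g ∘ Θ) (c.T (Θ v)) (Θ ⁻¹' K) v := by
    intro v hv
    have hg : HasFDerivAt c.g (fderiv ℝ c.g (Θ v)) (Θ v) :=
      ((c.differentiableOn.differentiableAt (c.isOpen.mem_nhds (hKW hv))).restrictScalars ℝ).hasFDerivAt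
    exact (hg.comp v Θ.hasFDerivAt).hasFDerivWithinAt
  have hinj : InjOn (c.g ∘ Θ) (Θ ⁻¹' K) := fun v hv v' hv' h ↦
    Θ.injective (c.injOn_g (hKW hv) (hKW hv') h)
  have h4 := integral_image_eq_integral_abs_det_fderiv_smul volume hS hderiv hinj
    (fun x ↦ ε * G x)
  have himage : (c.g ∘ Θ) '' (Θ ⁻¹' K) = c.g '' K := by
    rw [image_comp, image_preimage_eq K Θ.surjective]
  rw [himage] at h4
  simp only [smul_eq_mul, Function.comp_apply] at h4
  have h4' : ∫ v in Θ ⁻¹' K, ε * (|(c.T (Θ v)).det| * G (c.g (Θ v))) ∂volume =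
      ∫ x in c.g '' K, ε * G x ∂volume := by
    rw [h4]
    refine integral_congr_ae (Eventually.of_forall fun v ↦ ?_)
    ring
  -- Step 5: back to the ball
  have h5 : ∫ x in c.g '' K, ε * G x ∂volume = ∫ w in c.sheet K, ε * G w.1 ∂ballVolume := by
    rw [← c.image_val_sheet hKW]
    exact (BallModel.setIntegral_ballVolume (fun x ↦ ε * G x) (c.sheet K)).symm
  rw [h1, h2, h3, h4', h5, integral_const_mul, ← mul_assoc, mul_comm (ballHaarFactor : ℝ) ε]
  congr 1
  exact setIntegral_congr_fun (c.measurableSet_sheet hKc hKW) fun w _ ↦ hGball w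

end ChartInverseAt

end ChartPiece

end UnitaryBallUniformisationDatum

/-! ### Integrability of unfolded sheet integrands -/

namespace BallUnfolding

open UnitaryBallUniformisationDatum

variable {X₂ : Motives.SchemeOver ℂ} {D : UnitaryBallUniformisationDatum 2 X₂} (A : HodgeModel 2 X₂)
  {𝔣 : D.SylvesterFrame}

/-- **Integrability of the unfolded integrand.** For `Δ` the image of `Γ`, a measurable
fundamental domain `𝓕`, a measurable `V` inside a compact set and a continuous Jacobian-twisted
`f` (`f z = det_ℝ J(δ,z) • f (δ z)`), the function `𝟙_{Δ V} f` is integrable on `𝓕`: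
`∫_𝓕 ‖𝟙_{Δ V} f‖ ≤ Σ_δ ∫_𝓕 ‖𝟙_{δ⁻¹ V} f‖ = ∫ ‖𝟙_V f‖ < ∞`. [cite: Borel1997, §5.14] -/
theorem integrableOn_indicator_satur {F : Type*} [NormedAddCommGroup F] [NormedSpace ℝ F]
    {Δ : Subgroup U21} (hΔ : IsImageOfΓ D 𝔣 Δ)
    {𝓕 : Set Ball} (h𝓕 : IsFundamentalDomain Δ 𝓕 ballVolume) (h𝓕m : MeasurableSet 𝓕)
    {V C : Set Ball} (hVm : MeasurableSet V) (hC : IsCompact C) (hVC : V ⊆ C)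
    {f : Ball → F} (hfc : Continuous f)
    (htw : ∀ (δ : Δ) (z : Ball), f z = (jacCLM (δ : U21) z).det • f (δ • z)) :
    IntegrableOn ((satur Δ V).indicator f) 𝓕 ballVolume := by
  haveI : Countable Δ := hΔ.countable
  have hfC : IntegrableOn f C ballVolume := hfc.continuousOn.integrableOn_compact hC
  have hind : Integrable (V.indicator f) ballVolume := (hfC.mono_set hVC).integrable_indicator hVm
  have key : ∀ (δ : Δ) (z : Ball),
      ((jacCLM (δ : U21) z).det : ℝ) • V.indicator f (δ • z) =
        ((fun w ↦ δ • w) ⁻¹' V).indicator f z := by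
    intro δ z
    by_cases hz : δ • z ∈ V
    · rw [indicator_of_mem hz, indicator_of_mem (show z ∈ (fun w ↦ δ • w) ⁻¹' V from hz)]
      exact (htw δ z).symm
    · rw [indicator_of_notMem hz, indicator_of_notMem (show z ∉ (fun w ↦ δ • w) ⁻¹' V from hz),
        smul_zero]
  have hnorm : ∀ (δ : Δ) (z : Ball),
      ENNReal.ofReal (jacCLM (δ : U21) z).det * ‖V.indicator f (δ • z)‖ₑ =
        ‖((fun w ↦ δ • w) ⁻¹' V).indicator f z‖ₑ := by
    intro δ z
    rw [← key δ z, enorm_smul, Real.enorm_eq_ofReal (det_jacCLM_pos _ z).le]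
  have step3 : ∑' δ : Δ, ∫⁻ z in 𝓕, ‖((fun w ↦ δ • w) ⁻¹' V).indicator f z‖ₑ ∂ballVolume =
      ∫⁻ z, ‖V.indicator f z‖ₑ ∂ballVolume := by
    rw [lintegral_eq_tsum_smul h𝓕 h𝓕m]
    refine tsum_congr fun δ ↦ ?_
    rw [show (δ • 𝓕 : Set Ball) = (δ : U21) • 𝓕 from rfl,
      setLIntegral_smul_eq (δ : U21) h𝓕m fun z ↦ ‖V.indicator f z‖ₑ]
    refine setLIntegral_congr_fun h𝓕m fun z _ ↦ ?_
    exact (hnorm δ z).symm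
  have hpt : ∀ z : Ball,
      ‖(satur Δ V).indicator f z‖ₑ ≤ ∑' δ : Δ, ‖((fun w ↦ δ • w) ⁻¹' V).indicator f z‖ₑ := by
    intro z
    by_cases hz : z ∈ satur Δ V
    · obtain ⟨δ₀, hδ₀⟩ := hz
      rw [indicator_of_mem (show z ∈ satur Δ V from ⟨δ₀, hδ₀⟩)]
      calc ‖f z‖ₑ = ‖((fun w ↦ δ₀ • w) ⁻¹' V).indicator f z‖ₑ := by
            rw [indicator_of_mem (show z ∈ (fun w ↦ δ₀ • w) ⁻¹' V from hδ₀)]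
        _ ≤ ∑' δ : Δ, ‖((fun w ↦ δ • w) ⁻¹' V).indicator f z‖ₑ := ENNReal.le_tsum δ₀
    · rw [indicator_of_notMem hz, enorm_zero]
      exact bot_le
  refine ⟨(hfc.aestronglyMeasurable.indicator (measurableSet_satur Δ hVm)).restrict, ?_⟩
  unfold HasFiniteIntegral
  calc ∫⁻ z in 𝓕, ‖(satur Δ V).indicator f z‖ₑ ∂ballVolume
      ≤ ∫⁻ z in 𝓕, ∑' δ : Δ, ‖((fun w ↦ δ • w) ⁻¹' V).indicator f z‖ₑ ∂ballVolume :=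
        lintegral_mono fun z ↦ hpt z
    _ = ∑' δ : Δ, ∫⁻ z in 𝓕, ‖((fun w ↦ δ • w) ⁻¹' V).indicator f z‖ₑ ∂ballVolume :=
        lintegral_tsum fun δ ↦
          ((hfc.aestronglyMeasurable.indicator ((measurable_const_smul (δ : U21)) hVm)).restrict).enorm
    _ = ∫⁻ z, ‖V.indicator f z‖ₑ ∂ballVolume := step3
    _ < ⊤ := hind.2

end BallUnfolding

/-! ### The chart formula -/

namespace UnitaryBallUniformisationDatum

variable {X₂ : Motives.SchemeOver ℂ} (D : UnitaryBallUniformisationDatum 2 X₂) (A : HodgeModel 2 X₂)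
  (𝔣 : D.SylvesterFrame)

section Assembly

variable [MeasurableSpace A.model] [BorelSpace A.model] [Fact (finrank ℝ A.model = 4)]
  [CompactSpace A.carrier]

/-- **The chart formula, with integrability** (Warner (1983), 4.8; Lee (2013), Props. 16.4–16.6):
for a continuous orientation family `o`, a smooth top form `β` with continuous ball density, `Δ`
the image of `Γ` and `𝓕` a measurable fundamental domain of `Δ` in `𝔹²`, the density
`topDensity β` is integrable on `𝓕` and `∫_{(X, o)} β = ε(o) · κ · ∫_𝓕 topDensity β dλ`.
[cite: Lee2013, Ch. 16] -/
theorem integrableOn_topDensity_and_integral_eq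
    (o : (x : A.carrier) → Orientation ℝ (TangentSpace 𝓘(ℝ, A.model) x) (Fin 4))
    (ho : IsContinuousOrientation o) {β : MForm 𝓘(ℝ, A.model) A.carrier ℝ 4}
    (hβ : IsSmoothForm β) (hβc : Continuous (D.topDensity A 𝔣 β))
    {Δ : Subgroup U21} (hΔ : IsImageOfΓ D 𝔣 Δ)
    {𝓕 : Set Ball} (h𝓕 : IsFundamentalDomain Δ 𝓕 ballVolume) (h𝓕m : MeasurableSet 𝓕) :
    IntegrableOn (D.topDensity A 𝔣 β) 𝓕 ballVolume ∧
      MForm.integral o β = D.orientSign A 𝔣 o BallModel.x₀ * (ballHaarFactor : ℝ) *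
        ∫ z in 𝓕, D.topDensity A 𝔣 β z ∂ballVolume := by
  classical
  haveI : Countable Δ := hΔ.countable
  set ε := D.orientSign A 𝔣 o BallModel.x₀ with hεdef
  have hε : ∀ w : Ball, D.orientSign A 𝔣 o w = ε := fun w ↦ D.orientSign_eq A 𝔣 o ho w
  -- Step 1: a cover of `X` by patches carrying holomorphic local inverses of `ψ`
  have hcov : ∀ x : A.carrier, ∃ (z : Ball) (c : D.ChartInverseAt A 𝔣 x z) (r : ℝ), 0 < r ∧
      Metric.closedBall (extChartAt 𝓘(ℝ, A.model) x x) r ⊆ c.W := by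
    intro x
    obtain ⟨z, hz⟩ := D.exists_modelUnif_eq A 𝔣 x
    subst hz
    obtain ⟨c⟩ := D.nonempty_chartInverseAt A 𝔣 _ z (mem_chart_source A.model _)
    obtain ⟨r, hr, hrW⟩ :=
      Metric.nhds_basis_closedBall.mem_iff.1 (c.isOpen.mem_nhds c.center_mem)
    exact ⟨z, c, r, hr, hrW⟩
  choose zc c r hr hrW using hcov
  set U : A.carrier → Set A.carrier := fun x ↦ (extChartAt 𝓘(ℝ, A.model) x).source ∩
    extChartAt 𝓘(ℝ, A.model) x ⁻¹' Metric.ball (extChartAt 𝓘(ℝ, A.model) x x) (r x) with hU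
  have hUo : ∀ x, IsOpen (U x) := fun x ↦
    (continuousOn_extChartAt (I := 𝓘(ℝ, A.model)) x).isOpen_inter_preimage
      (isOpen_extChartAt_source (I := 𝓘(ℝ, A.model)) x) Metric.isOpen_ball
  have hUmem : ∀ x, x ∈ U x := fun x ↦
    ⟨mem_extChartAt_source (I := 𝓘(ℝ, A.model)) x, Metric.mem_ball_self (hr x)⟩
  have hcovU : (univ : Set A.carrier) ⊆ ⋃ x, U x := fun x _ ↦ mem_iUnion.2 ⟨x, hUmem x⟩
  obtain ⟨ρ, hρU⟩ :=
    SmoothPartitionOfUnity.exists_isSubordinate 𝓘(ℝ, A.model) isClosed_univ U hUo hcovU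
  have hsub : ρ.IsSubordinate fun x ↦ (chartAt A.model (id x)).source := by
    intro x
    refine (hρU x).trans fun p hp ↦ ?_
    change p ∈ (chartAt A.model x).source
    rw [← extChartAt_source 𝓘(ℝ, A.model)]
    exact hp.1
  -- Step 2: `∫ β` computed with `ρ`
  have hPU : MForm.integral o β = β.integralPU ρ o id :=
    (MForm.integralPU_eq_integral_holds o ρ id hsub ho hβ).symm
  -- Step 3: the pieces
  set K : A.carrier → Set A.model := fun x ↦
    Metric.closedBall (extChartAt 𝓘(ℝ, A.model) x x) (r x) with hK
  have hKc : ∀ x, IsCompact (K x) := fun x ↦ isCompact_closedBall _ _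
  have hKW : ∀ x, K x ⊆ (c x).W := hrW
  have hψc : Continuous fun z : Ball ↦ D.modelUnif A 𝔣 z.1 :=
    (D.continuousOn_modelUnif A 𝔣).comp_continuous continuous_subtype_val fun z ↦ z.2
  have hρc : ∀ x, Continuous fun z : Ball ↦ (ρ x (D.modelUnif A 𝔣 z.1) : ℝ) := fun x ↦
    (ρ x).contMDiff.continuous.comp hψc
  -- if `ρ x (p) ≠ 0` then `p ∈ U x`
  have hρUx : ∀ x p, ρ x p ≠ 0 → p ∈ U x := fun x p hp ↦ hρU x (subset_tsupport _ hp)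
  -- the integrand of piece `x`, and its twist
  set f : A.carrier → Ball → ℝ := fun x z ↦ ρ x (D.modelUnif A 𝔣 z.1) * D.topDensity A 𝔣 β z
    with hf
  have hfc : ∀ x, Continuous (f x) := fun x ↦ (hρc x).mul hβc
  have hftw : ∀ x (δ : Δ) (z : Ball), f x z = (jacCLM (δ : U21) z).det • f x (δ • z) := by
    intro x δ z
    obtain ⟨γ, hγ⟩ := (hΔ δ).1 δ.2
    have h := D.topDensity_eq_det_mul A 𝔣 β γ z
    rw [hγ] at h
    simp only [hf, smul_eq_mul]
    rw [h, show ((δ : U21) • z : Ball) = δ • z from rfl, hΔ.modelUnif_smul A δ z]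
    ring
  -- (i) + (ii) + (iii): the chart integral of piece `x` as an integral over `𝓕`
  have hpiece : ∀ x, ∫ y in (extChartAt 𝓘(ℝ, A.model) x).target,
      chartSign o x y * ρ x ((extChartAt 𝓘(ℝ, A.model) x).symm y) *
        β.inChart x y (modelBasis A.model 4) ∂(modelBasis A.model 4).addHaar =
      ε * (ballHaarFactor : ℝ) *
        ∫ z in 𝓕, (satur Δ ((c x).sheet (K x))).indicator (f x) z ∂ballVolume := by
    intro x
    -- (i) restrict to `K x`
    have hKt : K x ⊆ (extChartAt 𝓘(ℝ, A.model) x).target := fun y hy ↦ (c x).mem_target (hKW x hy)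
    rw [setIntegral_eq_of_subset_of_forall_sdiff_eq_zero (measurableSet_extChartAt_target x) hKt]
    swap
    · intro y hy
      have hρ0 : ρ x ((extChartAt 𝓘(ℝ, A.model) x).symm y) = 0 := by
        by_contra hne
        have hpU := hρUx x _ hne
        have hyb : y ∈ Metric.ball (extChartAt 𝓘(ℝ, A.model) x x) (r x) := by
          have h2 := hpU.2
          rw [mem_preimage, (extChartAt 𝓘(ℝ, A.model) x).right_inv hy.1] at h2
          exact h2
        exact hy.2 (Metric.ball_subset_closedBall hyb)
      rw [hρ0, mul_zero, zero_mul]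
    -- (ii) change of variables on `K x`
    rw [(c x).setIntegral_chartIntegrand_eq o hε (ρ x) β (hKc x) (hKW x)]
    -- (iii) unfold the sheet onto `𝓕`
    congr 1
    have hu := setIntegral_sheet_eq_setIntegral_fundamentalDomain A hΔ h𝓕 h𝓕m
      ((c x).measurableSet_sheet (hKc x) (hKW x)) ((c x).isCompact_sheet (hKc x) (hKW x))
      Subset.rfl ((c x).injOn_modelUnif_sheet (hKW x))
      (k := fun z ↦ ((ρ x (D.modelUnif A 𝔣 z.1) : ℝ) : ℂ))
      (h := fun z ↦ (D.topDensity A 𝔣 β z : ℂ))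
      (continuous_ofReal.comp (hρc x)) (continuous_ofReal.comp hβc)
      (fun δ z ↦ by simp only [hΔ.modelUnif_smul A δ z])
      (fun δ z ↦ by
        obtain ⟨γ, hγ⟩ := (hΔ δ).1 δ.2
        have h := D.topDensity_eq_det_mul A 𝔣 β γ z
        rw [hγ] at h
        rw [h, Complex.ofReal_mul]
        rfl)
    apply Complex.ofReal_injective
    rw [← integral_complex_ofReal, ← integral_complex_ofReal]
    have hl : ∫ z in (c x).sheet (K x), ((f x z : ℝ) : ℂ) ∂ballVolume =
        ∫ z in (c x).sheet (K x), ((ρ x (D.modelUnif A 𝔣 z.1) : ℝ) : ℂ) *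
          (D.topDensity A 𝔣 β z : ℂ) ∂ballVolume := by
      refine integral_congr_ae (Eventually.of_forall fun z ↦ ?_)
      simp only [hf, Complex.ofReal_mul]
    have hr' : ∫ z in 𝓕, (((satur Δ ((c x).sheet (K x))).indicator (f x) z : ℝ) : ℂ) ∂ballVolume =
        ∫ z in 𝓕, (satur Δ ((c x).sheet (K x))).indicator
          (fun z ↦ ((ρ x (D.modelUnif A 𝔣 z.1) : ℝ) : ℂ) * (D.topDensity A 𝔣 β z : ℂ)) z
            ∂ballVolume := by
      refine integral_congr_ae (Eventually.of_forall fun z ↦ ?_)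
      by_cases hz : z ∈ satur Δ ((c x).sheet (K x))
      · simp only [indicator_of_mem hz, hf, Complex.ofReal_mul]
      · simp only [indicator_of_notMem hz, Complex.ofReal_zero]
    rw [hl, hr', hu]
  -- integrability of the pieces on `𝓕`
  have hint : ∀ x, IntegrableOn ((satur Δ ((c x).sheet (K x))).indicator (f x)) 𝓕 ballVolume :=
    fun x ↦ integrableOn_indicator_satur hΔ h𝓕 h𝓕m ((c x).measurableSet_sheet (hKc x) (hKW x))
      ((c x).isCompact_sheet (hKc x) (hKW x)) Subset.rfl (hfc x) (hftw x)
  -- the pointwise identity `𝟙_{Δ S_x}(z) ρ_x(ψ z) = ρ_x(ψ z)`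
  have hpt : ∀ x (z : Ball), (satur Δ ((c x).sheet (K x))).indicator (f x) z = f x z := by
    intro x z
    by_cases hz : z ∈ satur Δ ((c x).sheet (K x))
    · exact indicator_of_mem hz _
    rw [indicator_of_notMem hz]
    by_contra hne
    have hρne : ρ x (D.modelUnif A 𝔣 z.1) ≠ 0 := by
      intro h0
      apply hne
      simp only [hf, h0, zero_mul]
    have hpU := hρUx x _ hρne
    set y := extChartAt 𝓘(ℝ, A.model) x (D.modelUnif A 𝔣 z.1) with hy
    have hyK : y ∈ K x := Metric.ball_subset_closedBall hpU.2
    have hyW : y ∈ (c x).W := hKW x hyK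
    have hwS : (c x).gBall hyW ∈ (c x).sheet (K x) := ⟨y, hyK, rfl⟩
    have hψw : D.modelUnif A 𝔣 z.1 = D.modelUnif A 𝔣 ((c x).gBall hyW).1 := by
      change _ = D.modelUnif A 𝔣 ((c x).g y)
      rw [← (c x).symm_eq y hyW, hy]
      exact ((extChartAt 𝓘(ℝ, A.model) x).left_inv hpU.1).symm
    obtain ⟨γ, hγ⟩ := (D.modelUnif_eq_iff A 𝔣 z ((c x).gBall hyW)).1 hψw
    apply hz
    refine ⟨⟨D.ballRep 𝔣 γ, (hΔ _).2 ⟨γ, rfl⟩⟩, ?_⟩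
    rw [show ((⟨D.ballRep 𝔣 γ, (hΔ _).2 ⟨γ, rfl⟩⟩ : Δ) • z : Ball) = D.ballRep 𝔣 γ • z from rfl, hγ]
    exact hwS
  -- Step 4: finite support and summation
  have hfin : {x : A.carrier | (support (ρ x : A.carrier → ℝ)).Nonempty}.Finite :=
    ρ.locallyFinite.finite_nonempty_of_compact
  set I₀ : Finset A.carrier := hfin.toFinset with hI₀
  have hzero : ∀ x, x ∉ I₀ → ∀ p, ρ x p = 0 := by
    intro x hx p
    by_contra hne
    exact hx (hfin.mem_toFinset.2 ⟨p, hne⟩)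
  have hsupp1 : (support fun x ↦ ∫ y in (extChartAt 𝓘(ℝ, A.model) x).target,
      chartSign o x y * ρ x ((extChartAt 𝓘(ℝ, A.model) x).symm y) *
        β.inChart x y (modelBasis A.model 4) ∂(modelBasis A.model 4).addHaar) ⊆ ↑I₀ := by
    intro x hx
    by_contra hxI
    apply hx
    simp only [hzero x hxI, mul_zero, zero_mul, integral_zero]
  -- the pieces sum to the density: `Σ_x 𝟙_{Δ S_x} ρ_x(ψ z) topDensity β z = topDensity β z`
  have hsumpt : ∀ z : Ball, ∑ x ∈ I₀, (satur Δ ((c x).sheet (K x))).indicator (f x) z =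
      D.topDensity A 𝔣 β z := by
    intro z
    simp only [hpt]
    have hsupp2 : (support fun x ↦ ρ x (D.modelUnif A 𝔣 z.1)) ⊆ ↑I₀ := by
      intro x hx
      exact hfin.mem_toFinset.2 ⟨_, hx⟩
    have h1 : ∑ x ∈ I₀, ρ x (D.modelUnif A 𝔣 z.1) = 1 := by
      rw [← finsum_eq_sum_of_support_subset _ hsupp2]
      exact ρ.sum_eq_one (mem_univ _)
    simp only [hf]
    rw [← Finset.sum_mul, h1, one_mul]
  have hintD : IntegrableOn (D.topDensity A 𝔣 β) 𝓕 ballVolume :=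
    (integrable_finsetSum I₀ fun x _ ↦ hint x).congr (Eventually.of_forall hsumpt)
  refine ⟨hintD, ?_⟩
  rw [hPU, MForm.integralPU]
  dsimp only [id_eq]
  rw [finsum_eq_sum_of_support_subset _ hsupp1, Finset.sum_congr rfl fun x _ ↦ hpiece x, ← Finset.mul_sum, ← integral_finsetSum I₀ fun x _ ↦ hint x]
  congr 1
  exact setIntegral_congr_fun h𝓕m fun z _ ↦ hsumpt z

/-- **The chart formula** (Warner (1983), 4.8; Lee (2013), Props. 16.4–16.6): for a continuous
orientation family `o`, a smooth top form `β` with continuous ball density, `Δ` the image of `Γ`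
and `𝓕` a measurable fundamental domain of `Δ` in `𝔹²`,
`∫_{(X, o)} β = ε(o) · κ · ∫_𝓕 topDensity β dλ`. [cite: Lee2013, Ch. 16] -/
theorem integral_eq_smul_setIntegral
    (o : (x : A.carrier) → Orientation ℝ (TangentSpace 𝓘(ℝ, A.model) x) (Fin 4))
    (ho : IsContinuousOrientation o) {β : MForm 𝓘(ℝ, A.model) A.carrier ℝ 4}
    (hβ : IsSmoothForm β) (hβc : Continuous (D.topDensity A 𝔣 β))
    {Δ : Subgroup U21} (hΔ : IsImageOfΓ D 𝔣 Δ)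
    {𝓕 : Set Ball} (h𝓕 : IsFundamentalDomain Δ 𝓕 ballVolume) (h𝓕m : MeasurableSet 𝓕) :
    MForm.integral o β = D.orientSign A 𝔣 o BallModel.x₀ * (ballHaarFactor : ℝ) *
      ∫ z in 𝓕, D.topDensity A 𝔣 β z ∂ballVolume :=
  (D.integrableOn_topDensity_and_integral_eq A 𝔣 o ho hβ hβc hΔ h𝓕 h𝓕m).2

end Assembly

end UnitaryBallUniformisationDatum

end Literature.AlgebraicGeometry.ShimuraVarieties
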